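import Mathlib
import HarnessLib
import Summits.ValiantsHypothesis.ValiantsHypothesis.Theorems.LacunarySymmetroidMatrixDescartesOsculationLawRankOneCurve

/-!
# ValiantsHypothesis / LacunarySymmetroid — crux `MatrixDescartes` (stmt-ValiantsHypothesis-18050, V1),
# line `Cruxes/MatrixDescartes/Lines/osculation_law.lean` («osculation-law»), stub `stub_peel` at RANK TWO:
# CONSEQUENCES OF HYPERBOLICITY (step (B3) of HOME/lmr/NOTE-p7g12-peel-r2-plan.md)

At rank two the spectral curve is `Φ(t,b) = a(t) b² + e(t) b + f(t)` (`a = det G₂₂`, `f = det G`, `e` the cofactor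
sum; `OsculationRankTwo.insertionPoly_two`) and symmetry makes it HYPERBOLIC: `Δ = e² − 4af ≥ 0` on `ℝ`
(`OsculationRankTwo.hdisc_two`).  This file draws the four consequences the per-branch bookkeeping needs, for
ARBITRARY `a e f : ℝ[X]` under the hypothesis `hΔ : ∀ t, 4·a(t)·f(t) ≤ e(t)²`:

* `derivative_discr_eval_eq_zero` — at a zero of `Δ` (a minimum of `Δ ≥ 0`) `Δ' = 0`;
* `no_fold` — a double `b`-root `b₀` of `Φ(t₀, ·)` with `a(t₀) ≠ 0` is a SINGULAR point of the curve:
  `∂_tΦ(t₀, b₀) = f' + e' b₀ + a' b₀² = 0` (eigenvalue branches of a hyperbolic family never fold);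
* `one_lt_rootMultiplicity_of_eval_e_eq_zero` — `f(t₀) = e(t₀) = 0 ≠ a(t₀)` forces `t₀` to be a multiple zero of
  `f` (both branches vanish: two zero events, paid by multiplicity);
* `one_lt_rootMultiplicity_of_eval_e_eq_zero'` — `a(t₀) = e(t₀) = 0 ≠ f(t₀)` forces a multiple zero of `a` (both
  branches escape);
* `eval_logHessian_eq_zero_of_singular` (any `Φ`) — the bordered log-Hessian (unfolded, as in the line) vanishes at
  singular points; `not_finite_of_vertical_ray` — `a = e = f = 0` at some `t₀ > 0` puts the whole ray
  `{(t₀, b) : b > 0}` in the osculation set (so finiteness forbids it); `false_of_double_root` — under the stub's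
  general-position clause no double `b`-root lies in the open quadrant.

Honest framing: bookkeeping for an OPEN stub; `stub_peel`, the LAW, `MatrixDescartes`, Conjecture B and
`VP ≠ VNP` are NOT proved.  No definitions, no named facts; Mathlib + the tree's `OsculationRankOne.eval_aevalX0`,
`pderiv_zero_aevalX0`, `pderiv_one_aevalX0`.
-/

-- `Summit.ValiantsHypothesis.ValiantsHypothesis.…` is the tree's mandated single-conjunct layout (Sub = Summit).
set_option linter.dupNamespace false

noncomputable section

namespace Summit.ValiantsHypothesis.ValiantsHypothesis.Theorems.LacunarySymmetroidMatrixDescartes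

open Polynomial Set
open scoped BigOperators

namespace OsculationPeel

/-! ### The discriminant at its zeros -/

/-- At a zero of the non-negative discriminant `Δ = e² − 4af`, `Δ' = 0`. [folklore] -/
theorem derivative_discr_eval_eq_zero (a e f : ℝ[X]) (hΔ : ∀ t, 4 * a.eval t * f.eval t ≤ e.eval t ^ 2) {t₀ : ℝ}
    (h0 : e.eval t₀ ^ 2 - 4 * a.eval t₀ * f.eval t₀ = 0) :
    2 * e.eval t₀ * (derivative e).eval t₀
      - 4 * ((derivative a).eval t₀ * f.eval t₀ + a.eval t₀ * (derivative f).eval t₀) = 0 := by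
  set D : ℝ[X] := e * e - 4 * a * f with hD
  have hDeval : ∀ t, D.eval t = e.eval t * e.eval t - 4 * a.eval t * f.eval t := fun t => by
    simp only [hD, eval_sub, eval_mul, eval_ofNat]
  have hmin : IsLocalMin (fun t => D.eval t) t₀ := by
    refine Filter.Eventually.of_forall fun t => ?_
    show D.eval t₀ ≤ D.eval t
    rw [hDeval, hDeval]
    nlinarith [hΔ t, h0]
  have hd := hmin.deriv_eq_zero
  rw [Polynomial.deriv] at hd
  have hD' : (derivative D).eval t₀ = 2 * e.eval t₀ * (derivative e).eval t₀
      - 4 * ((derivative a).eval t₀ * f.eval t₀ + a.eval t₀ * (derivative f).eval t₀) := by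
    simp only [hD, derivative_sub, derivative_mul, derivative_ofNat, eval_sub, eval_mul, eval_add,
      eval_ofNat, zero_mul, zero_add]
    ring
  rw [← hD', hd]

/-- **No fold.**  If `a(t₀) ≠ 0` and `b₀` is a double root of `b ↦ a(t₀) b² + e(t₀) b + f(t₀)`, then
`∂_tΦ(t₀, b₀) = f'(t₀) + e'(t₀) b₀ + a'(t₀) b₀² = 0`: the point `(t₀, b₀)` is singular on the spectral curve.
[folklore] -/
theorem no_fold (a e f : ℝ[X]) (hΔ : ∀ t, 4 * a.eval t * f.eval t ≤ e.eval t ^ 2) {t₀ b₀ : ℝ}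
    (ha : a.eval t₀ ≠ 0) (hroot : a.eval t₀ * b₀ ^ 2 + e.eval t₀ * b₀ + f.eval t₀ = 0)
    (hder : 2 * a.eval t₀ * b₀ + e.eval t₀ = 0) :
    (derivative f).eval t₀ + (derivative e).eval t₀ * b₀ + (derivative a).eval t₀ * b₀ ^ 2 = 0 := by
  have he : e.eval t₀ = -(2 * a.eval t₀ * b₀) := by linarith
  have hf : f.eval t₀ = a.eval t₀ * b₀ ^ 2 := by rw [he] at hroot; linarith
  have h0 : e.eval t₀ ^ 2 - 4 * a.eval t₀ * f.eval t₀ = 0 := by rw [he, hf]; ring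
  have hd := derivative_discr_eval_eq_zero a e f hΔ h0
  rw [he, hf] at hd
  have : -(4 * a.eval t₀) * ((derivative f).eval t₀ + (derivative e).eval t₀ * b₀ + (derivative a).eval t₀ * b₀ ^ 2) = 0 := by
    linear_combination hd
  rcases mul_eq_zero.1 this with h | h
  · exact absurd (by linarith : a.eval t₀ = 0) ha
  · exact h

/-- **Two zero events cost multiplicity two**: `f(t₀) = e(t₀) = 0 ≠ a(t₀)` ⇒ `t₀` is a multiple root of `f`. [folklore] -/
theorem one_lt_rootMultiplicity_of_eval_e_eq_zero (a e f : ℝ[X]) (hΔ : ∀ t, 4 * a.eval t * f.eval t ≤ e.eval t ^ 2)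
    {t₀ : ℝ} (hf : f ≠ 0) (ha : a.eval t₀ ≠ 0) (hf0 : f.eval t₀ = 0) (he0 : e.eval t₀ = 0) :
    1 < f.rootMultiplicity t₀ := by
  have hnf := no_fold a e f hΔ (b₀ := 0) ha (by rw [hf0, he0]; ring) (by rw [he0]; ring)
  simp only [mul_zero, add_zero, zero_pow two_ne_zero] at hnf
  rw [one_lt_rootMultiplicity_iff_isRoot_iterate_derivative hf]
  intro m hm
  interval_cases m
  · simpa using hf0
  · simpa using hnf

/-- **Two escapes cost multiplicity two**: `a(t₀) = e(t₀) = 0 ≠ f(t₀)` ⇒ `t₀` is a multiple root of `a`. [folklore] -/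
theorem one_lt_rootMultiplicity_of_eval_e_eq_zero' (a e f : ℝ[X]) (hΔ : ∀ t, 4 * a.eval t * f.eval t ≤ e.eval t ^ 2)
    {t₀ : ℝ} (ha : a ≠ 0) (ha0 : a.eval t₀ = 0) (he0 : e.eval t₀ = 0) (hf0 : f.eval t₀ ≠ 0) :
    1 < a.rootMultiplicity t₀ := by
  have hd := derivative_discr_eval_eq_zero a e f hΔ (t₀ := t₀) (by rw [ha0, he0]; ring)
  rw [ha0, he0] at hd
  have h' : (derivative a).eval t₀ * f.eval t₀ = 0 := by linarith
  have ha' : (derivative a).eval t₀ = 0 := by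
    rcases mul_eq_zero.1 h' with h | h
    · exact h
    · exact absurd h hf0
  rw [one_lt_rootMultiplicity_iff_isRoot_iterate_derivative ha]
  intro m hm
  interval_cases m
  · simpa using ha0
  · simpa using ha'

/-! ### The osculation set at singular points and on vertical rays -/

/-- The line's bordered log-Hessian (unfolded) **vanishes at every singular point** of `{Φ = 0}`: each of its
three terms carries a factor `X_i ∂_iΦ`. [folklore] -/
theorem eval_logHessian_eq_zero_of_singular (Φ : MvPolynomial (Fin 2) ℝ) (p : Fin 2 → ℝ)
    (h0 : MvPolynomial.eval p (MvPolynomial.pderiv 0 Φ) = 0) (h1 : MvPolynomial.eval p (MvPolynomial.pderiv 1 Φ) = 0) :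
    MvPolynomial.eval p
        (MvPolynomial.X 0 * MvPolynomial.pderiv 0 (MvPolynomial.X 0 * MvPolynomial.pderiv 0 Φ)
            * (MvPolynomial.X 1 * MvPolynomial.pderiv 1 Φ) ^ 2
          - 2 * (MvPolynomial.X 0 * MvPolynomial.pderiv 0 (MvPolynomial.X 1 * MvPolynomial.pderiv 1 Φ))
            * (MvPolynomial.X 0 * MvPolynomial.pderiv 0 Φ) * (MvPolynomial.X 1 * MvPolynomial.pderiv 1 Φ)
          + MvPolynomial.X 1 * MvPolynomial.pderiv 1 (MvPolynomial.X 1 * MvPolynomial.pderiv 1 Φ)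
            * (MvPolynomial.X 0 * MvPolynomial.pderiv 0 Φ) ^ 2) = 0 := by
  simp only [map_sub, map_add, map_mul, map_pow, h0, h1, mul_zero, zero_pow two_ne_zero, sub_zero, add_zero]

section RankTwoShape

variable (a e f : ℝ[X])

/-- `Φ(t,b) = b² a(t) + b e(t) + f(t)` for `Φ = X₁X₁·ι a + X₁·ι e + ι f` (the shape of
`OsculationRankTwo.insertionPoly_two`). [folklore] -/
theorem eval_Phi₂ (p : Fin 2 → ℝ) :
    MvPolynomial.eval p (MvPolynomial.X 1 * MvPolynomial.X 1 * Polynomial.aeval (MvPolynomial.X 0 : MvPolynomial (Fin 2) ℝ) a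
        + MvPolynomial.X 1 * Polynomial.aeval (MvPolynomial.X 0 : MvPolynomial (Fin 2) ℝ) e
        + Polynomial.aeval (MvPolynomial.X 0 : MvPolynomial (Fin 2) ℝ) f) =
      p 1 * p 1 * a.eval (p 0) + p 1 * e.eval (p 0) + f.eval (p 0) := by
  simp [OsculationRankOne.eval_aevalX0]

/-- `∂₁Φ = 2X₁·ι a + ι e` for the rank-two shape. [folklore] -/
theorem pderiv_one_Phi₂ :
    MvPolynomial.pderiv 1 (MvPolynomial.X 1 * MvPolynomial.X 1 * Polynomial.aeval (MvPolynomial.X 0 : MvPolynomial (Fin 2) ℝ) a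
        + MvPolynomial.X 1 * Polynomial.aeval (MvPolynomial.X 0 : MvPolynomial (Fin 2) ℝ) e
        + Polynomial.aeval (MvPolynomial.X 0 : MvPolynomial (Fin 2) ℝ) f) =
      MvPolynomial.X 1 * Polynomial.aeval (MvPolynomial.X 0 : MvPolynomial (Fin 2) ℝ) a
        + MvPolynomial.X 1 * Polynomial.aeval (MvPolynomial.X 0 : MvPolynomial (Fin 2) ℝ) a
        + Polynomial.aeval (MvPolynomial.X 0 : MvPolynomial (Fin 2) ℝ) e := by
  simp only [map_add, Derivation.leibniz, smul_eq_mul, MvPolynomial.pderiv_X_self, OsculationRankOne.pderiv_one_aevalX0,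
    mul_zero, zero_add, mul_one, add_zero]
  ring

/-- `∂₁Φ(t,b) = 2 b a(t) + e(t)`. [folklore] -/
theorem eval_pderiv_one_Phi₂ (p : Fin 2 → ℝ) :
    MvPolynomial.eval p (MvPolynomial.pderiv 1
        (MvPolynomial.X 1 * MvPolynomial.X 1 * Polynomial.aeval (MvPolynomial.X 0 : MvPolynomial (Fin 2) ℝ) a
        + MvPolynomial.X 1 * Polynomial.aeval (MvPolynomial.X 0 : MvPolynomial (Fin 2) ℝ) e
        + Polynomial.aeval (MvPolynomial.X 0 : MvPolynomial (Fin 2) ℝ) f)) =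
      2 * p 1 * a.eval (p 0) + e.eval (p 0) := by
  rw [pderiv_one_Phi₂]
  simp only [map_add, map_mul, MvPolynomial.eval_X, OsculationRankOne.eval_aevalX0]
  ring

/-- `∂₀Φ(t,b) = b² a'(t) + b e'(t) + f'(t)`. [folklore] -/
theorem eval_pderiv_zero_Phi₂ (p : Fin 2 → ℝ) :
    MvPolynomial.eval p (MvPolynomial.pderiv 0
        (MvPolynomial.X 1 * MvPolynomial.X 1 * Polynomial.aeval (MvPolynomial.X 0 : MvPolynomial (Fin 2) ℝ) a
        + MvPolynomial.X 1 * Polynomial.aeval (MvPolynomial.X 0 : MvPolynomial (Fin 2) ℝ) e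
        + Polynomial.aeval (MvPolynomial.X 0 : MvPolynomial (Fin 2) ℝ) f)) =
      p 1 * p 1 * (derivative a).eval (p 0) + p 1 * (derivative e).eval (p 0) + (derivative f).eval (p 0) := by
  simp only [map_add, Derivation.leibniz, smul_eq_mul, OsculationRankOne.pderiv_zero_aevalX0,
    MvPolynomial.pderiv_X_of_ne (show (1 : Fin 2) ≠ 0 by decide), map_mul, MvPolynomial.eval_X,
    OsculationRankOne.eval_aevalX0, mul_zero, add_zero]

/-- `∂₁∂₁Φ(t,b) = 2 a(t)`. [folklore] -/
theorem eval_pderiv_one_one_Phi₂ (p : Fin 2 → ℝ) :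
    MvPolynomial.eval p (MvPolynomial.pderiv 1 (MvPolynomial.pderiv 1
        (MvPolynomial.X 1 * MvPolynomial.X 1 * Polynomial.aeval (MvPolynomial.X 0 : MvPolynomial (Fin 2) ℝ) a
        + MvPolynomial.X 1 * Polynomial.aeval (MvPolynomial.X 0 : MvPolynomial (Fin 2) ℝ) e
        + Polynomial.aeval (MvPolynomial.X 0 : MvPolynomial (Fin 2) ℝ) f))) = 2 * a.eval (p 0) := by
  rw [pderiv_one_Phi₂]
  simp only [map_add, Derivation.leibniz, smul_eq_mul, MvPolynomial.pderiv_X_self, OsculationRankOne.pderiv_one_aevalX0,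
    mul_zero, zero_add, mul_one, OsculationRankOne.eval_aevalX0, add_zero]
  ring

/-- **No vertical ray**: if `a(t₀) = e(t₀) = f(t₀) = 0` for some `t₀ > 0`, every point `(t₀, b)`, `b > 0`, is an
osculation point (the curve contains the vertical line and `∂_bΦ ≡ 0`, `∂_b²Φ = 2a(t₀) = 0` on it), so the
osculation set is infinite. [folklore] -/
theorem not_finite_of_vertical_ray (Φ : MvPolynomial (Fin 2) ℝ)
    (hΦ : Φ = MvPolynomial.X 1 * MvPolynomial.X 1 * Polynomial.aeval (MvPolynomial.X 0 : MvPolynomial (Fin 2) ℝ) a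
        + MvPolynomial.X 1 * Polynomial.aeval (MvPolynomial.X 0 : MvPolynomial (Fin 2) ℝ) e
        + Polynomial.aeval (MvPolynomial.X 0 : MvPolynomial (Fin 2) ℝ) f)
    {t₀ : ℝ} (ht₀ : 0 < t₀) (ha0 : a.eval t₀ = 0) (he0 : e.eval t₀ = 0) (hf0 : f.eval t₀ = 0) :
    ¬ {p : Fin 2 → ℝ | 0 < p 0 ∧ 0 < p 1 ∧ MvPolynomial.eval p Φ = 0 ∧
      MvPolynomial.eval p
        (MvPolynomial.X 0 * MvPolynomial.pderiv 0 (MvPolynomial.X 0 * MvPolynomial.pderiv 0 Φ)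
            * (MvPolynomial.X 1 * MvPolynomial.pderiv 1 Φ) ^ 2
          - 2 * (MvPolynomial.X 0 * MvPolynomial.pderiv 0 (MvPolynomial.X 1 * MvPolynomial.pderiv 1 Φ))
            * (MvPolynomial.X 0 * MvPolynomial.pderiv 0 Φ) * (MvPolynomial.X 1 * MvPolynomial.pderiv 1 Φ)
          + MvPolynomial.X 1 * MvPolynomial.pderiv 1 (MvPolynomial.X 1 * MvPolynomial.pderiv 1 Φ)
            * (MvPolynomial.X 0 * MvPolynomial.pderiv 0 Φ) ^ 2) = 0}.Finite := by
  intro hfin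
  apply hfin.not_infinite
  refine Set.infinite_of_injOn_mapsTo (f := fun b : ℝ => (![t₀, b] : Fin 2 → ℝ)) ?_ ?_ (Set.Ioi_infinite 0)
  · intro b _ b' _ hbb'
    have := congr_fun hbb' 1
    simpa [Matrix.cons_val_one] using this
  · intro b hb
    rw [Set.mem_Ioi] at hb
    have hΦb : MvPolynomial.eval ![t₀, b] (MvPolynomial.pderiv 1 Φ) = 0 := by
      rw [hΦ, eval_pderiv_one_Phi₂]; simp [ha0, he0]
    have hΦbb : MvPolynomial.eval ![t₀, b] (MvPolynomial.pderiv 1 (MvPolynomial.pderiv 1 Φ)) = 0 := by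
      rw [hΦ, eval_pderiv_one_one_Phi₂]; simp [ha0]
    refine ⟨by simpa [Matrix.cons_val_zero] using ht₀, by simpa [Matrix.cons_val_one] using hb, ?_, ?_⟩
    · rw [hΦ, eval_Phi₂]; simp [ha0, he0, hf0]
    · simp only [map_sub, map_add, map_mul, map_pow, Derivation.leibniz, smul_eq_mul, MvPolynomial.pderiv_X_self,
        MvPolynomial.eval_X, hΦb, hΦbb, mul_zero, add_zero, zero_mul, zero_pow two_ne_zero, sub_zero, mul_one]

/-- **No double root in the open quadrant** under general position: if `a(t₀) ≠ 0` and `b₀ > 0`, `t₀ > 0` is a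
double `b`-root of `Φ(t₀, ·)`, then (no fold) `(t₀, b₀)` is a singular point, hence an osculation point with
`∂_bΦ = 0`, which the stub's general-position clause excludes. [folklore] -/
theorem false_of_double_root (hΔ : ∀ t, 4 * a.eval t * f.eval t ≤ e.eval t ^ 2) (Φ : MvPolynomial (Fin 2) ℝ)
    (hΦ : Φ = MvPolynomial.X 1 * MvPolynomial.X 1 * Polynomial.aeval (MvPolynomial.X 0 : MvPolynomial (Fin 2) ℝ) a
        + MvPolynomial.X 1 * Polynomial.aeval (MvPolynomial.X 0 : MvPolynomial (Fin 2) ℝ) e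
        + Polynomial.aeval (MvPolynomial.X 0 : MvPolynomial (Fin 2) ℝ) f)
    (hgp : ∀ p ∈ {p : Fin 2 → ℝ | 0 < p 0 ∧ 0 < p 1 ∧ MvPolynomial.eval p Φ = 0 ∧
      MvPolynomial.eval p
        (MvPolynomial.X 0 * MvPolynomial.pderiv 0 (MvPolynomial.X 0 * MvPolynomial.pderiv 0 Φ)
            * (MvPolynomial.X 1 * MvPolynomial.pderiv 1 Φ) ^ 2
          - 2 * (MvPolynomial.X 0 * MvPolynomial.pderiv 0 (MvPolynomial.X 1 * MvPolynomial.pderiv 1 Φ))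
            * (MvPolynomial.X 0 * MvPolynomial.pderiv 0 Φ) * (MvPolynomial.X 1 * MvPolynomial.pderiv 1 Φ)
          + MvPolynomial.X 1 * MvPolynomial.pderiv 1 (MvPolynomial.X 1 * MvPolynomial.pderiv 1 Φ)
            * (MvPolynomial.X 0 * MvPolynomial.pderiv 0 Φ) ^ 2) = 0},
        MvPolynomial.eval p (MvPolynomial.pderiv 1 Φ) ≠ 0)
    {t₀ b₀ : ℝ} (ht₀ : 0 < t₀) (hb₀ : 0 < b₀) (ha : a.eval t₀ ≠ 0)
    (hroot : a.eval t₀ * b₀ ^ 2 + e.eval t₀ * b₀ + f.eval t₀ = 0) (hder : 2 * a.eval t₀ * b₀ + e.eval t₀ = 0) : False := by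
  have hsing := no_fold a e f hΔ ha hroot hder
  have h0 : MvPolynomial.eval ![t₀, b₀] (MvPolynomial.pderiv 0 Φ) = 0 := by
    rw [hΦ, eval_pderiv_zero_Phi₂]
    simp only [Matrix.cons_val_one, Matrix.cons_val_zero]
    linear_combination hsing
  have h1 : MvPolynomial.eval ![t₀, b₀] (MvPolynomial.pderiv 1 Φ) = 0 := by
    rw [hΦ, eval_pderiv_one_Phi₂]
    simp only [Matrix.cons_val_one, Matrix.cons_val_zero]
    linear_combination hder
  refine hgp ![t₀, b₀] ⟨by simpa using ht₀, by simpa using hb₀, ?_, eval_logHessian_eq_zero_of_singular Φ _ h0 h1⟩ h1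
  rw [hΦ, eval_Phi₂]
  simp only [Matrix.cons_val_one, Matrix.cons_val_zero]
  linear_combination hroot

end RankTwoShape

end OsculationPeel

end Summit.ValiantsHypothesis.ValiantsHypothesis.Theorems.LacunarySymmetroidMatrixDescartes

end
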